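import Summits.Ventures.Crystal3D.Theorems.StickyWulffConstantCoaxialWallLawOneFccSlabVolume
import Summits.Ventures.Crystal3D.Theorems.StickyWulffConstantTextureLiminfCellFlux
import Summits.Ventures.Crystal3D.Theorems.StickyWulffConstantGenericWallFloorShellCount
import HarnessLib

/-!
# The ONE-FCC F_layer: the CHARGE of a slice in chord currency (file (j) of the two-family ledger)

HONEST FRAMING. Venture `Summits/Ventures/Crystal3D` (cell `crystal3d-full`); helper `--supports` the crux `CoaxialWallLaw`
(stmt-Ventures-19481, REGISTERED line `WallLedgerF`) in its role as owner of lane T's debt T-F2 / F_layer, OneFcc half (cf-p1 (civ)/(cxx);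
memo HOME/wall-19481-p1/g16/TWO-FAMILY-LEDGER-g16.md §Ledger (I4)).  Measure theory only; census-free, standard axioms; nothing about the
crux is claimed; F-C1 not moved.

After `two_charge_le_mismatch_of_twinFamily` (…TexShadowOneFccCharge) and the frame dictionary the charge of the slice
`S_z(ρ) = {z ≤ q₂ ≤ z+1, q₀² + q₁² ≤ ρ²}` is `≤ Σ'_i θ·ch_i·|S_z(ρ) ∩ laySlab L s i|`, `θ = sin∠(L e₃, e₃) = √(1 − ν₂²)`, `ch_i ∈ [0,1]`.
* `volume_shiftedSlice_inter_laySlab` — vertical translation: `|S_z(ρ') ∩ laySlab L s i| = |S_0(ρ') ∩ laySlab L (s − z e₃) i|`;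
* `volume_shiftedSlice`, `abs_cellPoint_le` — the slice is a cylinder of volume `π ρ'²`; the cell point `p_i` nearest `0` minimises `|·|`;
* **`oneFcc_charge_le`** — (I4): `Σ'_i θ ch_i |S_z(ρ) ∩ slab_i| ≤ (2d/θ) Σ_{i ∈ W} ch_i G(p_i) + 8πρ`, `G(x) = √(((ρ−4)² θ² − x²)₊)`,
  `p_i = max (x_i − 1) (min 0 (x_{i+1} + 1))`, `x_i = (L⁻¹ s)₂ − z ν₂ + i d`, for every finite `W` holding the slabs that meet `S_z(ρ)`
  (inner slice `ρ − 4` by `volume_slice_inter_laySlab_le`, …OneFccSlabVolume; the annulus `(ρ−4, ρ]` is partitioned by the slabs, `≤ 8πρ`).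
WHAT THIS IS NOT: the sources, the ledger, the assembly; F-C1 not moved.
-/

noncomputable section

namespace Summit.Ventures.Crystal3D.Theorems

open MeasureTheory Set Finset
open scoped ENNReal InnerProductSpace
open Summit.Ventures.Crystal3D
open Summit.Ventures.Crystal3D.Cruxes.TextureLiminf.TexShadow (E3 laySlab)

/-- **Vertical translation of the slice.** -/
theorem volume_shiftedSlice_inter_laySlab (L : E3 ≃ₗᵢ[ℝ] E3) (s : E3) (i : ℤ) (ρ' z : ℝ) :
    volume ({q : E3 | z ≤ q 2 ∧ q 2 ≤ z + 1 ∧ q 0 ^ 2 + q 1 ^ 2 ≤ ρ' ^ 2} ∩ laySlab L s i) =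
      volume ({q : E3 | 0 ≤ q 2 ∧ q 2 ≤ 1 ∧ q 0 ^ 2 + q 1 ^ 2 ≤ ρ' ^ 2} ∩
        laySlab L (s - z • EuclideanSpace.single (2 : Fin 3) (1 : ℝ)) i) := by
  set v : E3 := z • EuclideanSpace.single (2 : Fin 3) (1 : ℝ) with hv
  have hv0 : v 0 = 0 := by simp [hv]
  have hv1 : v 1 = 0 := by simp [hv]
  have hv2 : v 2 = z := by simp [hv]
  have hset : {q : E3 | z ≤ q 2 ∧ q 2 ≤ z + 1 ∧ q 0 ^ 2 + q 1 ^ 2 ≤ ρ' ^ 2} ∩ laySlab L s i =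
      (fun q : E3 => q + -v) ⁻¹' ({q : E3 | 0 ≤ q 2 ∧ q 2 ≤ 1 ∧ q 0 ^ 2 + q 1 ^ 2 ≤ ρ' ^ 2} ∩ laySlab L (s - v) i) := by
    ext q
    simp only [Set.mem_inter_iff, Set.mem_setOf_eq, Set.mem_preimage, PiLp.add_apply, PiLp.neg_apply, hv0, hv1, hv2,
      neg_zero, add_zero]
    constructor
    · rintro ⟨⟨h1, h2, h3⟩, r, hr, hrq⟩
      have hrq' : L r + s = q := hrq
      refine ⟨⟨by linarith, by linarith, h3⟩, r, hr, ?_⟩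
      show L r + (s - v) = q + -v
      rw [← hrq']; abel
    · rintro ⟨⟨h1, h2, h3⟩, r, hr, hrq⟩
      have hrq' : L r + (s - v) = q + -v := hrq
      refine ⟨⟨by linarith, by linarith, h3⟩, r, hr, ?_⟩
      show L r + s = q
      calc L r + s = L r + (s - v) + v := by abel
        _ = q + -v + v := by rw [hrq']
        _ = q := by abel
  rw [hset, measure_preimage_add_right]

/-- The shifted slice is a cylinder of volume `π ρ'²`. -/
theorem volume_shiftedSlice (ρ' z : ℝ) (hρ' : 0 ≤ ρ') :
    volume {q : E3 | z ≤ q 2 ∧ q 2 ≤ z + 1 ∧ q 0 ^ 2 + q 1 ^ 2 ≤ ρ' ^ 2} = ENNReal.ofReal (Real.pi * ρ' ^ 2) := by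
  have hset : {q : E3 | z ≤ q 2 ∧ q 2 ≤ z + 1 ∧ q 0 ^ 2 + q 1 ^ 2 ≤ ρ' ^ 2} =
      {y : E3 | y 0 ^ 2 + y 1 ^ 2 ≤ ρ' ^ 2 ∧ z ≤ y 2 ∧ y 2 ≤ z + 1} := by
    ext y; simp only [Set.mem_setOf_eq]; tauto
  rw [hset, volume_cyl ρ' z (z + 1) hρ', add_sub_cancel_left, ENNReal.ofReal_one, one_mul, ← ENNReal.ofReal_pow hρ',
    ← ENNReal.ofReal_mul (by positivity), mul_comm]

/-- The shifted slice is measurable. -/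
theorem measurableSet_shiftedSlice (ρ' z : ℝ) :
    MeasurableSet {q : E3 | z ≤ q 2 ∧ q 2 ≤ z + 1 ∧ q 0 ^ 2 + q 1 ^ 2 ≤ ρ' ^ 2} := by
  have hset : {q : E3 | z ≤ q 2 ∧ q 2 ≤ z + 1 ∧ q 0 ^ 2 + q 1 ^ 2 ≤ ρ' ^ 2} =
      {y : E3 | y 0 ^ 2 + y 1 ^ 2 ≤ ρ' ^ 2 ∧ z ≤ y 2 ∧ y 2 ≤ z + 1} := by
    ext y; simp only [Set.mem_setOf_eq]; tauto
  rw [hset]; exact measurableSet_cyl ρ' z (z + 1)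

/-- **The cell point nearest `0` minimises `|·|` on the cell** `[a, b]`. -/
theorem abs_cellPoint_le (a b y : ℝ) (hy : a ≤ y ∧ y ≤ b) : |max a (min 0 b)| ≤ |y| := by
  rcases le_or_gt 0 a with ha | ha
  · rw [min_eq_left (ha.trans (hy.1.trans hy.2)), max_eq_left ha, abs_of_nonneg ha, abs_of_nonneg (ha.trans hy.1)]
    exact hy.1
  rcases le_or_gt 0 b with hb | hb
  · rw [min_eq_left hb, max_eq_right ha.le, abs_zero]; exact abs_nonneg y
  · rw [min_eq_right hb.le, max_eq_right (by linarith : a ≤ b), abs_of_neg hb, abs_of_neg (lt_of_le_of_lt hy.2 hb)]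
    linarith [hy.2]

/-- **(I4) THE CHARGE OF A SLICE IN CHORD CURRENCY.**  See the module docstring. -/
theorem oneFcc_charge_le (L : E3 ≃ₗᵢ[ℝ] E3) (s : E3) (ch : ℤ → ℝ) (hch : ∀ i, 0 ≤ ch i ∧ ch i ≤ 1) (ρ z : ℝ) (hρ : 4 ≤ ρ)
    (hS2 : 0 < 1 - (L.symm (EuclideanSpace.single (2 : Fin 3) (1 : ℝ))) 2 ^ 2) (W : Finset ℤ)
    (hW : ∀ i : ℤ, ({q : E3 | z ≤ q 2 ∧ q 2 ≤ z + 1 ∧ q 0 ^ 2 + q 1 ^ 2 ≤ ρ ^ 2} ∩ laySlab L s i).Nonempty → i ∈ W) :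
    ∑' i : ℤ, (Real.sqrt (1 - (L.symm (EuclideanSpace.single (2 : Fin 3) (1 : ℝ))) 2 ^ 2) * ch i) *
        (volume ({q : E3 | z ≤ q 2 ∧ q 2 ≤ z + 1 ∧ q 0 ^ 2 + q 1 ^ 2 ≤ ρ ^ 2} ∩ laySlab L s i)).toReal ≤
      2 * Real.sqrt (2 / 3) / Real.sqrt (1 - (L.symm (EuclideanSpace.single (2 : Fin 3) (1 : ℝ))) 2 ^ 2) *
        ∑ i ∈ W, ch i * Real.sqrt (max 0 ((ρ - 4) ^ 2 * (1 - (L.symm (EuclideanSpace.single (2 : Fin 3) (1 : ℝ))) 2 ^ 2) -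
          (max ((L.symm s) 2 - z * (L.symm (EuclideanSpace.single (2 : Fin 3) (1 : ℝ))) 2 + i * Real.sqrt (2 / 3) - 1)
            (min 0 ((L.symm s) 2 - z * (L.symm (EuclideanSpace.single (2 : Fin 3) (1 : ℝ))) 2 + (i + 1) * Real.sqrt (2 / 3) + 1))) ^ 2)) +
      Real.pi * (8 * ρ) := by
  set e₃ : E3 := EuclideanSpace.single (2 : Fin 3) (1 : ℝ) with he₃
  set ν₂ : ℝ := (L.symm e₃) 2 with hν₂
  set S2 : ℝ := 1 - ν₂ ^ 2 with hS2def
  set θ : ℝ := Real.sqrt S2 with hθ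
  set d : ℝ := Real.sqrt (2 / 3) with hd
  set Sρ : Set E3 := {q : E3 | z ≤ q 2 ∧ q 2 ≤ z + 1 ∧ q 0 ^ 2 + q 1 ^ 2 ≤ ρ ^ 2} with hSρ
  set Sin : Set E3 := {q : E3 | z ≤ q 2 ∧ q 2 ≤ z + 1 ∧ q 0 ^ 2 + q 1 ^ 2 ≤ (ρ - 4) ^ 2} with hSin
  set x₀ : ℝ := (L.symm s) 2 - z * ν₂ with hx₀
  set G : ℤ → ℝ := fun i => Real.sqrt (max 0 ((ρ - 4) ^ 2 * S2 -
    (max (x₀ + i * d - 1) (min 0 (x₀ + (i + 1) * d + 1))) ^ 2)) with hG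
  have hθpos : 0 < θ := Real.sqrt_pos.2 hS2
  have hθsq : θ ^ 2 = S2 := Real.sq_sqrt hS2.le
  have hd0 : 0 ≤ d := Real.sqrt_nonneg _
  have hG0 : ∀ i, 0 ≤ G i := fun i => Real.sqrt_nonneg _
  have hν₂1 : |ν₂| ≤ 1 := by
    rw [← sq_le_one_iff_abs_le_one]; linarith
  -- measurability / volumes
  have hSρm : MeasurableSet Sρ := measurableSet_shiftedSlice ρ z
  have hSinm : MeasurableSet Sin := measurableSet_shiftedSlice (ρ - 4) z
  have hsub : Sin ⊆ Sρ := fun q ⟨h1, h2, h3⟩ => ⟨h1, h2, h3.trans (by nlinarith)⟩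
  have hvolρ : volume Sρ = ENNReal.ofReal (Real.pi * ρ ^ 2) := volume_shiftedSlice ρ z (by linarith)
  have hvolin : volume Sin = ENNReal.ofReal (Real.pi * (ρ - 4) ^ 2) := volume_shiftedSlice (ρ - 4) z (by linarith)
  have hfinρ : volume Sρ ≠ ⊤ := by rw [hvolρ]; exact ENNReal.ofReal_ne_top
  have hfinin : volume Sin ≠ ⊤ := by rw [hvolin]; exact ENNReal.ofReal_ne_top
  have hfin_i : ∀ i, volume (Sρ ∩ laySlab L s i) ≠ ⊤ := fun i => ne_top_of_le_ne_top hfinρ (measure_mono Set.inter_subset_left)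
  -- per slab: the inner slice in chord currency
  have hx : (L.symm (s - z • e₃)) 2 = x₀ := by
    rw [map_sub, LinearIsometryEquiv.map_smul, PiLp.sub_apply, PiLp.smul_apply, smul_eq_mul]
  have hin : ∀ i : ℤ, volume (Sin ∩ laySlab L s i) ≤ ENNReal.ofReal (2 * d * G i / S2) := by
    intro i
    rw [hSin, volume_shiftedSlice_inter_laySlab L s i (ρ - 4) z]
    refine volume_slice_inter_laySlab_le L (s - z • e₃) i (ρ - 4) (G i) (hG0 i) hS2 fun c zz h1 h2 h3 h4 => ?_
    rw [hx] at h1 h2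
    have hGsq : G i ^ 2 = max 0 ((ρ - 4) ^ 2 * S2 - (max (x₀ + i * d - 1) (min 0 (x₀ + (i + 1) * d + 1))) ^ 2) :=
      Real.sq_sqrt (le_max_left _ _)
    have hzν : |zz * ν₂| ≤ 1 := by
      rw [abs_mul, abs_of_nonneg h3]; nlinarith [abs_nonneg ν₂]
    have hy : x₀ + i * d - 1 ≤ c - zz * ν₂ ∧ c - zz * ν₂ ≤ x₀ + (i + 1) * d + 1 := by
      constructor
      · linarith [le_abs_self (zz * ν₂)]
      · linarith [neg_abs_le (zz * ν₂)]
    have hp := abs_cellPoint_le _ _ _ hy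
    have hp2 := sq_le_sq.2 hp
    rw [hGsq]
    exact le_trans (by linarith) (le_max_right _ _)
  -- off the window the slabs miss the slice
  have hzero : ∀ i ∉ W, volume (Sin ∩ laySlab L s i) = 0 := by
    intro i hi
    have hempty : Sρ ∩ laySlab L s i = ∅ := by
      by_contra hne
      exact hi (hW i (Set.nonempty_iff_ne_empty.2 hne))
    exact measure_mono_null (fun q hq => (hempty ▸ ⟨hsub hq.1, hq.2⟩ : q ∈ (∅ : Set E3))) (measure_empty)
  -- the main estimate in `ℝ≥0∞`
  have hcoef1 : ∀ i, ENNReal.ofReal (θ * ch i) ≤ 1 := by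
    intro i
    rw [← ENNReal.ofReal_one]
    refine ENNReal.ofReal_le_ofReal ?_
    have hθ1 : θ ≤ 1 := by
      rw [hθ, show (1 : ℝ) = Real.sqrt 1 from Real.sqrt_one.symm]
      exact Real.sqrt_le_sqrt (by nlinarith [sq_nonneg ν₂])
    nlinarith [(hch i).1, (hch i).2, hθpos]
  have key : ∑' i : ℤ, ENNReal.ofReal (θ * ch i) * volume (Sρ ∩ laySlab L s i) ≤
      (∑ i ∈ W, ENNReal.ofReal (θ * ch i) * ENNReal.ofReal (2 * d * G i / S2)) + volume (Sρ \ Sin) := by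
    calc ∑' i : ℤ, ENNReal.ofReal (θ * ch i) * volume (Sρ ∩ laySlab L s i)
        ≤ ∑' i : ℤ, (ENNReal.ofReal (θ * ch i) * volume (Sin ∩ laySlab L s i) + volume ((Sρ \ Sin) ∩ laySlab L s i)) := by
          refine ENNReal.tsum_le_tsum fun i => ?_
          have hsplit : Sρ ∩ laySlab L s i ⊆ (Sin ∩ laySlab L s i) ∪ ((Sρ \ Sin) ∩ laySlab L s i) := by
            intro q hq
            by_cases hqi : q ∈ Sin
            · exact Or.inl ⟨hqi, hq.2⟩
            · exact Or.inr ⟨⟨hq.1, hqi⟩, hq.2⟩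
          calc ENNReal.ofReal (θ * ch i) * volume (Sρ ∩ laySlab L s i)
              ≤ ENNReal.ofReal (θ * ch i) * (volume (Sin ∩ laySlab L s i) + volume ((Sρ \ Sin) ∩ laySlab L s i)) :=
                mul_le_mul_right ((measure_mono hsplit).trans (measure_union_le _ _)) _
            _ = ENNReal.ofReal (θ * ch i) * volume (Sin ∩ laySlab L s i) +
                  ENNReal.ofReal (θ * ch i) * volume ((Sρ \ Sin) ∩ laySlab L s i) := mul_add _ _ _
            _ ≤ ENNReal.ofReal (θ * ch i) * volume (Sin ∩ laySlab L s i) + 1 * volume ((Sρ \ Sin) ∩ laySlab L s i) :=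
                add_le_add le_rfl (mul_le_mul_left (hcoef1 i) _)
            _ = _ := by rw [one_mul]
      _ = ∑' i : ℤ, ENNReal.ofReal (θ * ch i) * volume (Sin ∩ laySlab L s i) + ∑' i : ℤ, volume ((Sρ \ Sin) ∩ laySlab L s i) :=
          ENNReal.tsum_add
      _ = (∑ i ∈ W, ENNReal.ofReal (θ * ch i) * volume (Sin ∩ laySlab L s i)) + volume (Sρ \ Sin) := by
          congr 1
          · exact tsum_eq_sum fun i hi => by rw [hzero i hi, mul_zero]
          · exact (measure_eq_tsum_inter_laySlab L s (Sρ \ Sin) (hSρm.diff hSinm)).symm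
      _ ≤ (∑ i ∈ W, ENNReal.ofReal (θ * ch i) * ENNReal.ofReal (2 * d * G i / S2)) + volume (Sρ \ Sin) :=
          add_le_add (Finset.sum_le_sum fun i _ => mul_le_mul_right (hin i) _) le_rfl
  -- back to `ℝ`
  have hL : ∑' i : ℤ, (θ * ch i) * (volume (Sρ ∩ laySlab L s i)).toReal =
      (∑' i : ℤ, ENNReal.ofReal (θ * ch i) * volume (Sρ ∩ laySlab L s i)).toReal := by
    rw [ENNReal.tsum_toReal_eq fun i => ENNReal.mul_ne_top ENNReal.ofReal_ne_top (hfin_i i)]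
    refine tsum_congr fun i => ?_
    rw [ENNReal.toReal_mul, ENNReal.toReal_ofReal (mul_nonneg hθpos.le (hch i).1)]
  have hdiff : volume (Sρ \ Sin) = volume Sρ - volume Sin := measure_sdiff hsub hSinm.nullMeasurableSet hfinin
  have hdiff_fin : volume (Sρ \ Sin) ≠ ⊤ := ne_top_of_le_ne_top hfinρ (measure_mono Set.sdiff_subset)
  have hsum_fin : (∑ i ∈ W, ENNReal.ofReal (θ * ch i) * ENNReal.ofReal (2 * d * G i / S2)) ≠ ⊤ :=
    ENNReal.sum_ne_top.2 fun i _ => ENNReal.mul_ne_top ENNReal.ofReal_ne_top ENNReal.ofReal_ne_top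
  have hR : ((∑ i ∈ W, ENNReal.ofReal (θ * ch i) * ENNReal.ofReal (2 * d * G i / S2)) + volume (Sρ \ Sin)).toReal =
      ∑ i ∈ W, θ * ch i * (2 * d * G i / S2) + (Real.pi * ρ ^ 2 - Real.pi * (ρ - 4) ^ 2) := by
    rw [ENNReal.toReal_add hsum_fin hdiff_fin, ENNReal.toReal_sum fun i _ =>
      ENNReal.mul_ne_top ENNReal.ofReal_ne_top ENNReal.ofReal_ne_top]
    congr 1
    · refine Finset.sum_congr rfl fun i _ => ?_
      rw [ENNReal.toReal_mul, ENNReal.toReal_ofReal (mul_nonneg hθpos.le (hch i).1),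
        ENNReal.toReal_ofReal (div_nonneg (by nlinarith [hG0 i, hd0]) hS2.le)]
    · rw [hdiff, ENNReal.toReal_sub_of_le (measure_mono hsub) hfinρ, hvolρ, hvolin,
        ENNReal.toReal_ofReal (by positivity), ENNReal.toReal_ofReal (by positivity)]
  rw [hL]
  refine (ENNReal.toReal_mono (ENNReal.add_ne_top.2 ⟨hsum_fin, hdiff_fin⟩) key).trans ?_
  rw [hR, Finset.mul_sum]
  have hρ0 : 0 ≤ ρ := by linarith
  refine add_le_add (le_of_eq (Finset.sum_congr rfl fun i _ => ?_)) (by nlinarith [Real.pi_pos])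
  have : θ * (2 * d) / S2 = 2 * d / θ := by
    rw [← hθsq]; field_simp
  calc θ * ch i * (2 * d * G i / S2) = (θ * (2 * d) / S2) * (ch i * G i) := by ring
    _ = 2 * d / θ * (ch i * G i) := by rw [this]

end Summit.Ventures.Crystal3D.Theorems

end
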